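import Summits.CriticalPhenomena.CardyFormulaZ2.Theorems.CardySelfDualSegmentUniformMarginalityMixedApproximantsPart2
import Summits.CriticalPhenomena.CardyFormulaZ2.Theorems.CardySelfDualSegmentUniformMarginalityStubArcsClose
import Summits.CriticalPhenomena.CardyFormulaZ2.Theorems.CardySelfDualSegmentUniformMarginalityStubUpperOfClose
import Summits.CriticalPhenomena.CardyFormulaZ2.Theorems.CardySelfDualSegmentUniformMarginalityStubLowerOfClose
import Summits.CriticalPhenomena.CardyFormulaZ2.Theorems.CardyIKTransportCornerLineDescentCrudeContinuity

/-!
# Fixed-parameter domain continuity of crude crossing probabilities from Schramm–Smirnov's discrete estimate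
(5.1), for an ARBITRARY law on bond configurations (line `Sketch`, crux `UniformMarginality`,
stmt-CriticalPhenomena-5472)

The CardyIKTransport bridge `Freeze.crudeCrossingContinuity_of_discrete` ((5.1) for critical bond-ℤ² at the chart
quad of `R` ⟹ `Freeze.CrudeCrossingContinuity R`) and the lead's endpoint assembly (crude continuity ⟹
fixed-parameter domain continuity at every `ε₀`-close conformal rectangle, via the transferred sandwiches
`stub_crossEvent_subset_upperCrossing_of_close` / `stub_lowerCrossing_subset_crossEvent_of_close`) use the percolation
law only through (5.1), finiteness, and "configurations lie on the lattice edges a.s.".  This file records both steps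
for an arbitrary finite measure `μ` on `BondConfig (Site 2)` carried by lattice configurations, so that they apply
verbatim to every member `M_t = cornerPercolation t` of the self-dual corner family
(`cornerPercolation_subset_edgeSet`).  Consequence for the line: the open-interval transport kernel (B₂ᵒ) of skeleton
v9 IS Schramm–Smirnov's discrete estimate (5.1) for the single model `M_{t₀}` (skeleton v10), and nothing else.

* `crudeContinuityFor_of_discrete` — (5.1) for `μ` at every quad of the plane ⟹ for every conformal rectangle `R` and
  `ε > 0`: `μ(upper R ρ δ) ≤ μ(lower R κ ρ δ) + ε` eventually as `δ → 0⁺` (copy of the Freeze proof with `μ`).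
* `fixedDomainContinuityFor_of_crudeContinuity` — that conclusion for all `R` ⟹ `|μ(crossEvent Q δ) − μ(crossEvent R δ)| ≤ ε`
  for all `Q` `ε₀`-close to `R` (loop + marks) and `0 < δ < δ₀` (one threshold).
-/

noncomputable section

namespace Summit.CriticalPhenomena.CardyFormulaZ2.Cruxes.UniformMarginality.HeatFlow

open scoped Topology ENNReal
open Set Metric Filter MeasureTheory
open Literature.Probability.Percolation Literature.Probability.LatticeModels
  Literature.Probability.RandomPlanarGeometry
open Literature.Probability.Percolation.QuadCrossing (Quad)
open Literature.Probability.Percolation.QuadCrossing.Quad (Dominated StrictlyDominated)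
open Summit.CriticalPhenomena.CardyFormulaZ2.Theorems.CornerLineDescent.SymmetricSeed
open Summit.CriticalPhenomena.CardyFormulaZ2.Theorems.CornerLineDescent.SymmetricSeed.Freeze
  (tmodel chartQuad fatQuad thinQuad fatQuad_eq thinQuad_eq exists_radius_left exists_radius_right exists_modulus
    dist_chartQuad_le exists_upper_gap exists_lower_data)
open Summit.CriticalPhenomena.CardyFormulaZ2.Theorems.RectilinearApproximation
  (carrier_subset_cthickening_of_dist_boundary_le)

/-! ## Step 1: Schramm–Smirnov (5.1) for `μ` ⟹ crude continuity for `μ` (the Freeze bridge, general law) -/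

/-- **The Freeze bridge for a general law.**  Let `μ` be a finite measure on bond configurations of `ℤ²` carried by
lattice configurations.  If `μ` satisfies Schramm–Smirnov's discrete continuity estimate (5.1) at every quad of the
plane — for every `Q₀` and `ε > 0` there are `Q' < Q₀ < Q''` and `δ₀ > 0` with
`μ[Q' crossed inside the open edges ∧ Q'' not] ≤ ε` for `0 < δ < δ₀` — then for every conformal rectangle `R` and
`ε > 0` there are a collar scale `κ > 0` and a radius `ρ > 0` with `μ(upper R ρ δ) ≤ μ(lower R κ ρ δ) + ε` for all
small meshes (the events of `Freeze.CrudeCrossingContinuity`).  Proof copied from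
`Freeze.crudeCrossingContinuity_of_discrete` (chart quad of the transposed square model, domination radii, the
fat/thin chart quads, `exists_upper_gap`, `exists_lower_data`), with `P_{1/2}` replaced by `μ`. -/
theorem crudeContinuityFor_of_discrete (μ : Measure (BondConfig (Site 2))) [IsFiniteMeasure μ]
    (hμ : ∀ᵐ ω ∂μ, ω ⊆ (zdGraph 2).edgeSet)
    (h51 : ∀ (Q₀ : Quad (univ : Set ℂ)) (ε : ℝ≥0∞), 0 < ε →
      ∃ Q' Q'' : Quad (univ : Set ℂ), StrictlyDominated Q' Q₀ ∧ StrictlyDominated Q₀ Q'' ∧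
        ∃ δ₀ : ℝ, 0 < δ₀ ∧ ∀ δ : ℝ, 0 < δ → δ < δ₀ →
          μ {ω | (∃ K, Q'.IsCrossing K ∧ K ⊆ openEdgeUnion δ ω) ∧
              ¬ ∃ K, Q''.IsCrossing K ∧ K ⊆ openEdgeUnion δ ω} ≤ ε)
    (R : ConformalRectangle) :
    ∀ ε : ℝ, 0 < ε → ∃ κ : ℝ, 0 < κ ∧ ∃ ρ : ℝ, 0 < ρ ∧ ∀ᶠ δ in 𝓝[>] (0:ℝ),
      μ.real (Freeze.upperCrossing R ρ δ) ≤ μ.real (Freeze.lowerCrossing R κ ρ δ) + ε := by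
  intro ε hε
  obtain ⟨Φ, hΦ⟩ := exists_isSquareModel R
  set Ψ := tmodel Φ with hΨ
  obtain ⟨Q', Q'', hQ', hQ'', δ₀, hδ₀, hE⟩ :=
    h51 (chartQuad Ψ (-1) 1 (-1) 1 (by norm_num) (by norm_num)) (ENNReal.ofReal ε) (ENNReal.ofReal_pos.2 hε)
  obtain ⟨r₁, hr₁, hdom₁⟩ := exists_radius_left hQ'
  obtain ⟨r₂, hr₂, hdom₂⟩ := exists_radius_right hQ''
  have hr₁₂ : 0 < min r₁ r₂ / 2 := half_pos (lt_min hr₁ hr₂)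
  obtain ⟨θ, hθ, hmod⟩ := exists_modulus Ψ hr₁₂
  set s : ℝ := min (1 / 2) (θ / 4) with hsdef
  have hs : 0 < s := lt_min one_half_pos (by positivity)
  have hs1 : s ≤ 1 / 2 := min_le_left _ _
  have hsθ : 4 * s ≤ θ := by rw [hsdef]; linarith [min_le_right (1 / 2 : ℝ) (θ / 4)]
  obtain ⟨g, hg, hup⟩ := exists_upper_gap hΦ hs hs1
  obtain ⟨t, ht, hts, κ, hκ, r, hr, hlow⟩ := exists_lower_data hΦ hs hs1 hs
  -- domination of the two chart quads
  have hdomP : Dominated Q' (fatQuad Ψ s) := by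
    rw [fatQuad_eq _ hs (by linarith)]
    refine hdom₁ _ ((dist_chartQuad_le hr₁₂.le hmod _ _ ⟨by linarith, by linarith⟩ ⟨by linarith, by linarith⟩
      ⟨by linarith, by linarith⟩ ⟨by linarith, by linarith⟩ ?_).trans_lt ?_)
    · have e1 : -1 + s + 1 = s := by ring
      have e2 : 1 - s - 1 = -s := by ring
      have e3 : -1 - s + 1 = -s := by ring
      have e4 : 1 + s - 1 = s := by ring
      rw [e1, e2, e3, e4, abs_neg, abs_of_pos hs]
      linarith
    · linarith [min_le_left r₁ r₂]
  have hdomM : Dominated (thinQuad Ψ t s) Q'' := by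
    rw [thinQuad_eq _ ht hs (by linarith)]
    refine hdom₂ _ ((dist_chartQuad_le hr₁₂.le hmod _ _ ⟨by linarith, by linarith⟩ ⟨by linarith, by linarith⟩
      ⟨by linarith, by linarith⟩ ⟨by linarith, by linarith⟩ ?_).trans_lt ?_)
    · have e1 : -1 - t + 1 = -t := by ring
      have e2 : 1 + t - 1 = t := by ring
      have e3 : -1 + s + 1 = s := by ring
      have e4 : 1 - s - 1 = -s := by ring
      rw [e1, e2, e3, e4, abs_neg, abs_neg, abs_of_pos hs, abs_of_pos ht]
      linarith
    · linarith [min_le_right r₁ r₂]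
  -- the radius and the meshes
  refine ⟨κ, hκ, min g r / 2, by positivity, ?_⟩
  have hev : ∀ᶠ δ in 𝓝[>] (0 : ℝ), δ ∈ Ioo (0 : ℝ) (min (min g r / 4) (δ₀ / 2)) :=
    Ioo_mem_nhdsGT (by positivity)
  filter_upwards [hev] with δ hδ
  rw [mem_Ioo] at hδ
  obtain ⟨hδ, hδ'⟩ := hδ
  have hδgr : δ < min g r / 4 := hδ'.trans_le (min_le_left _ _)
  have hδδ₀ : δ < δ₀ / 2 := hδ'.trans_le (min_le_right _ _)
  have hsq2 : Real.sqrt 2 < 2 := by linarith [Real.sqrt_two_lt_three_halves]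
  have hm2 : δ * Real.sqrt 2 < 2 * δ := by nlinarith
  have hmpos : 0 < δ * Real.sqrt 2 := by positivity
  have hmδ₀ : δ * Real.sqrt 2 < δ₀ := by linarith
  have hmg : δ * Real.sqrt 2 + min g r / 2 ≤ g := by linarith [min_le_left g r]
  have hmr : δ * Real.sqrt 2 + min g r / 2 ≤ r := by linarith [min_le_right g r]
  have hρ : 0 ≤ min g r / 2 := by positivity
  set ρ : ℝ := min g r / 2 with hρdef
  set m : ℝ := δ * Real.sqrt 2 with hm
  set E : Set (BondConfig (Site 2)) := {ω | (∃ K, Q'.IsCrossing K ∧ K ⊆ openEdgeUnion m ω) ∧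
    ¬ ∃ K, Q''.IsCrossing K ∧ K ⊆ openEdgeUnion m ω} with hEdef
  set G : Set (BondConfig (Site 2)) := {ω | ω ⊆ (zdGraph 2).edgeSet} with hGdef
  -- the inclusion of events
  have hincl : Freeze.upperCrossing R ρ δ ⊆ Freeze.lowerCrossing R κ ρ δ ∪ (E ∪ Gᶜ) := by
    intro ω hωup
    by_cases hωG : ω ⊆ (zdGraph 2).edgeSet
    swap
    · exact Or.inr (Or.inr hωG)
    by_cases hlowK : ∃ K, Q''.IsCrossing K ∧ K ⊆ openEdgeUnion m ω
    · obtain ⟨K, hK, hKO⟩ := hlowK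
      obtain ⟨K', hK'K, hK'⟩ := hdomM K hK
      exact Or.inl (hlow δ ρ hδ hρ hmr ω K' hK' (hK'K.trans hKO))
    · obtain ⟨K, hK, hKO⟩ := hup δ ρ hδ hρ hmg ω hωG hωup
      obtain ⟨K', hK'K, hK'⟩ := hdomP K hK
      exact Or.inr (Or.inl ⟨⟨K', hK', hK'K.trans hKO⟩, hlowK⟩)
  -- the measures
  have hGc : μ.real Gᶜ = 0 := by
    rw [measureReal_def, ENNReal.toReal_eq_zero_iff]
    left
    have hae := hμ
    rw [Filter.Eventually, MeasureTheory.mem_ae_iff] at hae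
    exact hae
  have hEε : μ.real E ≤ ε := ENNReal.toReal_le_of_le_ofReal hε.le (hE m hmpos hmδ₀)
  calc μ.real (Freeze.upperCrossing R ρ δ)
      ≤ μ.real (Freeze.lowerCrossing R κ ρ δ ∪ (E ∪ Gᶜ)) := measureReal_mono hincl
    _ ≤ μ.real (Freeze.lowerCrossing R κ ρ δ) + μ.real (E ∪ Gᶜ) := measureReal_union_le _ _
    _ ≤ μ.real (Freeze.lowerCrossing R κ ρ δ) + (μ.real E + μ.real Gᶜ) := by
        gcongr
        exact measureReal_union_le _ _
    _ ≤ μ.real (Freeze.lowerCrossing R κ ρ δ) + ε := by rw [hGc, add_zero]; gcongr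

/-! ## Step 2: crude continuity for `μ` ⟹ fixed-parameter domain continuity for `μ` -/

/-- Real-valued monotonicity of a finite measure along an a.e. inclusion. -/
theorem measureReal_mono_of_ae {α : Type*} [MeasurableSpace α] {μ : Measure α} [IsFiniteMeasure μ]
    {s t : Set α} (h : ∀ᵐ x ∂μ, x ∈ s → x ∈ t) : μ.real s ≤ μ.real t := by
  simp only [measureReal_def]
  exact ENNReal.toReal_mono (measure_ne_top _ _) (measure_mono_ae h)

/-- **Fixed-parameter domain continuity for a general law from its crude continuity.**  Let `μ` be a finite measure
on bond configurations of `ℤ²` carried by lattice configurations, with `μ(upper R ρ δ) ≤ μ(lower R κ ρ δ) + ε`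
eventually in the mesh for every conformal rectangle `R` and `ε > 0` (Step 1).  Then for every `R` and `ε > 0` there
are `ε₀ > 0` and ONE threshold `δ₀ > 0` such that every conformal rectangle `Q`, `ε₀`-close to `R` in boundary loop
and marks, has `|μ(crossEvent Q δ) − μ(crossEvent R δ)| ≤ ε` for `0 < δ < δ₀`, by the landed closeness package
`stub_arcs_close_of_loop_close` and the transferred sandwiches `stub_crossEvent_subset_upperCrossing_of_close`,
`stub_lowerCrossing_subset_crossEvent_of_close`. -/
theorem fixedDomainContinuityFor_of_crudeContinuity (μ : Measure (BondConfig (Site 2))) [IsFiniteMeasure μ]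
    (hμ : ∀ᵐ ω ∂μ, ω ⊆ (zdGraph 2).edgeSet)
    (hccc : ∀ (R : ConformalRectangle) (ε : ℝ), 0 < ε → ∃ κ : ℝ, 0 < κ ∧ ∃ ρ : ℝ, 0 < ρ ∧
      ∀ᶠ δ in 𝓝[>] (0:ℝ), μ.real (Freeze.upperCrossing R ρ δ) ≤ μ.real (Freeze.lowerCrossing R κ ρ δ) + ε) :
    ∀ (R : ConformalRectangle) (ε : ℝ), 0 < ε → ∃ ε₀ > 0, ∃ δ₀ > 0, ∀ Q : ConformalRectangle,
      (∀ u : ℝ, dist (Q.boundary u) (R.boundary u) ≤ ε₀) → (∀ i : Fin 4, |Q.mark i - R.mark i| ≤ ε₀) →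
      ∀ δ : ℝ, 0 < δ → δ < δ₀ → |μ.real (crossEvent Q δ) - μ.real (crossEvent R δ)| ≤ ε := by
  intro R ε hε
  obtain ⟨κ, hκ, ρ, hρ, hev⟩ := hccc R ε hε
  obtain ⟨δ₁, hδ₁, hδ₁P⟩ := mem_nhdsGT_iff_exists_Ioo_subset.1 hev
  rw [mem_Ioi] at hδ₁
  -- the closeness scale
  set η : ℝ := min (ρ / 2) (κ / 4) with hη
  have hη0 : 0 < η := lt_min (by positivity) (by positivity)
  have hηρ : η ≤ ρ / 2 := min_le_left _ _
  have hηκ : η ≤ κ / 4 := min_le_right _ _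
  obtain ⟨ε₁, hε₁, hclose⟩ := stub_arcs_close_of_loop_close R η hη0
  refine ⟨min ε₁ η, lt_min hε₁ hη0, min δ₁ (min (ρ / 4) (κ / 8)),
    lt_min hδ₁ (lt_min (by positivity) (by positivity)), fun Q hb hm δ hδ hδlt => ?_⟩
  -- the geometry of `Q` relative to `R`
  have hb' : ∀ u : ℝ, dist (Q.boundary u) (R.boundary u) ≤ ε₁ := fun u => (hb u).trans (min_le_left _ _)
  have hm' : ∀ i : Fin 4, |Q.mark i - R.mark i| ≤ ε₁ := fun i => (hm i).trans (min_le_left _ _)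
  have harcs := hclose Q hb' hm'
  have hcar : Q.carrier ⊆ Metric.cthickening η R.carrier :=
    (carrier_subset_cthickening_of_dist_boundary_le R.toJordanDomain Q.toJordanDomain hb).trans
      (Metric.cthickening_mono (min_le_right _ _) _)
  have hdeep : ∀ z ∈ R.carrier, (∀ w ∈ frontier R.carrier, η < dist z w) → z ∈ Q.carrier :=
    fun z hz hw => MixedApprox.mem_carrier_of_forall_lt_dist R.toJordanDomain Q.toJordanDomain hb hz
      fun w hw' => lt_of_le_of_lt (min_le_right _ _) (hw w hw')
  -- the mesh inequalities
  have hδ₁' : δ < δ₁ := hδlt.trans_le (min_le_left _ _)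
  have hδρ : δ < ρ / 4 := hδlt.trans_le ((min_le_right _ _).trans (min_le_left _ _))
  have hδκ : δ < κ / 8 := hδlt.trans_le ((min_le_right _ _).trans (min_le_right _ _))
  have hs2 : Real.sqrt 2 < 2 := by linarith [Real.sqrt_two_lt_three_halves]
  have hs0 : 0 ≤ Real.sqrt 2 := Real.sqrt_nonneg 2
  have h2δη : 2 * δ + η ≤ ρ := by linarith
  have h2δ : 2 * δ ≤ ρ := by linarith
  have hsδ : Real.sqrt 2 * δ ≤ κ := by nlinarith
  have hsδ3 : Real.sqrt 2 * δ + 3 * η ≤ κ := by nlinarith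
  -- the continuity estimate at this mesh
  have hP : μ.real (Freeze.upperCrossing R ρ δ) ≤ μ.real (Freeze.lowerCrossing R κ ρ δ) + ε := hδ₁P ⟨hδ, hδ₁'⟩
  -- four comparisons
  have h1 : μ.real (crossEvent Q δ) ≤ μ.real (Freeze.upperCrossing R ρ δ) :=
    measureReal_mono (stub_crossEvent_subset_upperCrossing_of_close R Q η ρ δ hδ.le hη0.le hcar (harcs 0).1
      (harcs 2).1 h2δη)
  have h2 : μ.real (Freeze.lowerCrossing R κ ρ δ) ≤ μ.real (crossEvent R δ) := by
    refine measureReal_mono_of_ae ?_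
    filter_upwards [hμ] with ω hω hlow
    exact Freeze.lowerCrossing_subset_embDomainCrossing R hδ hρ.le hsδ hω hlow
  have h3 : μ.real (crossEvent R δ) ≤ μ.real (Freeze.upperCrossing R ρ δ) :=
    measureReal_mono (crude_subset_upperCrossing R ρ δ hδ.le h2δ)
  have h4 : μ.real (Freeze.lowerCrossing R κ ρ δ) ≤ μ.real (crossEvent Q δ) := by
    refine measureReal_mono_of_ae ?_
    filter_upwards [hμ] with ω hω hlow
    exact stub_lowerCrossing_subset_crossEvent_of_close R Q η κ ρ δ hδ hη0.le (by linarith) hsδ3 hcar hdeep harcs ω hω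
      hlow
  rw [abs_le]
  constructor <;> linarith

/-! ## Step 3: the corner family — (5.1) for `M_{t₀}` ⟹ the fixed-parameter kernel (B₂a″) at `t₀` -/

/-- **For every parameter `t₀ ∈ [0,1]`: Schramm–Smirnov's discrete estimate (5.1) for the single model `M_{t₀}`
implies the fixed-parameter transport kernel (B₂a″) of the line at `t₀`** (in exactly the shape consumed by the
glue; rectilinearity of `Q` unused).  So the open-interval kernel (B₂ᵒ) of skeleton v9
reduces to (5.1) for `M_{t₀}`, `0 < t₀ < 1` — the research statement of skeleton v10. -/
theorem fixedDomainContinuityAt_of_discrete :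
    ∀ t₀ : unitInterval,
      (∀ (Q₀ : Quad (univ : Set ℂ)) (ε : ℝ≥0∞), 0 < ε →
        ∃ Q' Q'' : Quad (univ : Set ℂ), StrictlyDominated Q' Q₀ ∧ StrictlyDominated Q₀ Q'' ∧
          ∃ δ₀ : ℝ, 0 < δ₀ ∧ ∀ δ : ℝ, 0 < δ → δ < δ₀ →
            cornerPercolation t₀ {ω | (∃ K, Q'.IsCrossing K ∧ K ⊆ openEdgeUnion δ ω) ∧
                ¬ ∃ K, Q''.IsCrossing K ∧ K ⊆ openEdgeUnion δ ω} ≤ ε) →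
      ∀ (R : ConformalRectangle) (ε : ℝ), 0 < ε → ∃ ε₀ > 0, ∀ Q : ConformalRectangle,
        (∃ S : Finset (ℂ × ℂ), (∀ p ∈ S, p.1.re = p.2.re ∨ p.1.im = p.2.im) ∧
          frontier Q.carrier ⊆ ⋃ p ∈ S, segment ℝ p.1 p.2) →
        (∀ u : ℝ, dist (Q.boundary u) (R.boundary u) ≤ ε₀) → (∀ i : Fin 4, |Q.mark i - R.mark i| ≤ ε₀) →
        ∃ δ₀ > 0, ∀ δ : ℝ, 0 < δ → δ < δ₀ → |Pext Q δ t₀ - Pext R δ t₀| ≤ ε := by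
  intro t₀ h51 R ε hε
  have hM : M (t₀ : ℝ) = cornerPercolation t₀ := by
    unfold M
    rw [Set.projIcc_val]
  obtain ⟨ε₀, hε₀, δ₀, hδ₀, h⟩ := fixedDomainContinuityFor_of_crudeContinuity (cornerPercolation t₀)
    (cornerPercolation_subset_edgeSet _)
    (crudeContinuityFor_of_discrete (cornerPercolation t₀) (cornerPercolation_subset_edgeSet _) h51) R ε hε
  refine ⟨ε₀, hε₀, fun Q _ hb hm => ⟨δ₀, hδ₀, fun δ hδ hδlt => ?_⟩⟩
  rw [Pext_eq_M, Pext_eq_M, hM]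
  exact h Q hb hm δ hδ hδlt

end Summit.CriticalPhenomena.CardyFormulaZ2.Cruxes.UniformMarginality.HeatFlow

end
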